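import Summits.RiemannHypothesis.RiemannHypothesis.Theorems.HandoffDodgerAsymptoticsC
import Summits.RiemannHypothesis.RiemannHypothesis.Theorems.HandoffDodgerAsymptoticsD
import HarnessLib

/-!
# HANDOFF — SMALL THRESHOLD (5): the size of the profile value `Φ(9y²/64)` at `y = 2L^{3/2}` for every `b ≥ 11/2` (rh-explicit, D-0040 WEIL column prover seat handoff-prove-2 gen11, ATTEMPT-21 §6)

HONEST FRAMING. Nothing here bears on the truth of RH; elementary real analysis (Mathlib + gen10's Stirling single-term minorant
`profileTerm_ge_stirling` and `exp_numerics`). For the profile series `Φ = Σ_m x^m/(m!(2m)!)` (a `HasSum` hypothesis, as in gen10's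
part (C)) at the schedule `y = 2L^{3/2}` of ATTEMPT-21, `x = 9y²/64 = (9/16)L³ ≥ (9/2)b³` (`2b ≤ L`), we prove the profile-value
inequality consumed by `HandoffDodgerSmallCost.cost_lt_gain_small`:
**`154000·(b + 1.84)·e^{2b} < Φ²` for every `b ≥ 11/2`** (`profile_value_small`), in two regimes: `11/2 ≤ b < 7` by the partial sums
`Σ_{n ≤ 10} x^n/(n!(2n)!)` at `x = 748.6875` and `x = 972` (exact rational arithmetic), and `b ≥ 7` by the single term `m = ⌊b⌋`,
`x^m/(m!(2m)!) ≥ 22.5^m/(e²√2·m)`, against `1.25·10⁸(m+3)m²·7.39^m < 506^m` (induction from `m = 7`). gen10's `profile_value_lower`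
(`Φ(81L³/1600) ≥ e^{30L/43−3}/(3L)`, `L ≥ 43`) is too weak below `L ≈ 200` for this comparison. No `sorry`, standard axioms.

References: this track (ATTEMPT-16 §5 Lemma D3; ATTEMPT-19 §8 (P6); ATTEMPT-21 §6).
-/

set_option linter.dupNamespace false

noncomputable section

open Real Finset

namespace Summit.RiemannHypothesis.RiemannHypothesis.Theorems.Handoff

/-! ## Partial sums of the profile series -/

/-- A partial sum of the (nonnegative) profile series is below its sum. [folklore] -/
theorem profileSum_le_of_hasSum {x Φ : ℝ} (hx : 0 ≤ x)
    (hΦ : HasSum (fun m : ℕ => x ^ m / ((m.factorial : ℝ) * ((2 * m).factorial : ℝ))) Φ) (N : ℕ) :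
    ∑ n ∈ range N, x ^ n / ((n.factorial : ℝ) * ((2 * n).factorial : ℝ)) ≤ Φ :=
  sum_le_hasSum (range N) (fun n _ => by positivity) hΦ

/-- A single term of the profile series is below its sum. [folklore] -/
theorem profileTerm_le_of_hasSum {x Φ : ℝ} (hx : 0 ≤ x)
    (hΦ : HasSum (fun m : ℕ => x ^ m / ((m.factorial : ℝ) * ((2 * m).factorial : ℝ))) Φ) (m : ℕ) :
    x ^ m / ((m.factorial : ℝ) * ((2 * m).factorial : ℝ)) ≤ Φ :=
  le_hasSum hΦ m (fun n _ => by positivity)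

/-- The partial sums are monotone in `x ≥ 0`. [folklore] -/
theorem profileSum_mono {x₀ x : ℝ} (hx₀ : 0 ≤ x₀) (hx : x₀ ≤ x) (N : ℕ) :
    ∑ n ∈ range N, x₀ ^ n / ((n.factorial : ℝ) * ((2 * n).factorial : ℝ)) ≤
      ∑ n ∈ range N, x ^ n / ((n.factorial : ℝ) * ((2 * n).factorial : ℝ)) :=
  sum_le_sum fun n _ => div_le_div_of_nonneg_right (pow_le_pow_left₀ hx₀ hx n) (by positivity)

/-- `Σ_{n ≤ 10} x^n/(n!(2n)!) ≥ 1.9·10⁶` at `x = 748.6875 = (9/2)·(11/2)³`. [this track, ATTEMPT-21 §6] -/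
theorem profileSum_ge_cell_one :
    (1900000 : ℝ) ≤ ∑ n ∈ range 11, ((11979 : ℝ) / 16) ^ n / ((n.factorial : ℝ) * ((2 * n).factorial : ℝ)) := by
  simp only [sum_range_succ, sum_range_zero, Nat.factorial]
  norm_num

/-- `Σ_{n ≤ 10} x^n/(n!(2n)!) ≥ 8.8·10⁶` at `x = 972 = (9/2)·6³`. [this track, ATTEMPT-21 §6] -/
theorem profileSum_ge_cell_two :
    (8800000 : ℝ) ≤ ∑ n ∈ range 11, (972 : ℝ) ^ n / ((n.factorial : ℝ) * ((2 * n).factorial : ℝ)) := by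
  simp only [sum_range_succ, sum_range_zero, Nat.factorial]
  norm_num

/-! ## Numerics -/

/-- `e^{12} ≤ 162755` and `e^{14} ≤ 1202605`. [folklore] -/
theorem exp_twelve_fourteen_le : Real.exp 12 ≤ 162755 ∧ Real.exp 14 ≤ 1202605 := by
  have h12 : Real.exp 12 = Real.exp 1 ^ 12 := by exact_mod_cast (Real.exp_one_pow 12).symm
  have h14 : Real.exp 14 = Real.exp 1 ^ 14 := by exact_mod_cast (Real.exp_one_pow 14).symm
  have h0 := (Real.exp_pos 1).le
  have hlt := Real.exp_one_lt_d9
  constructor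
  · rw [h12]; exact le_trans (pow_le_pow_left₀ h0 hlt.le 12) (by norm_num)
  · rw [h14]; exact le_trans (pow_le_pow_left₀ h0 hlt.le 14) (by norm_num)

/-- `e³ ≥ 20.06` and `e²√2 ≤ 10.452`. [folklore] -/
theorem exp_three_sqrt_two_bounds : (20.06 : ℝ) ≤ Real.exp 3 ∧ Real.exp 2 * Real.sqrt 2 ≤ 10.452 := by
  have h3 : Real.exp 3 = Real.exp 1 ^ 3 := by exact_mod_cast (Real.exp_one_pow 3).symm
  have hgt := Real.exp_one_gt_d9
  have hs : Real.sqrt 2 ≤ 1.4143 := by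
    rw [show (1.4143 : ℝ) = Real.sqrt (1.4143 ^ 2) by rw [Real.sqrt_sq]; norm_num]
    exact Real.sqrt_le_sqrt (by norm_num)
  constructor
  · rw [h3]; exact le_trans (by norm_num) (pow_le_pow_left₀ (by norm_num) hgt.le 3)
  · calc Real.exp 2 * Real.sqrt 2 ≤ 7.39 * 1.4143 :=
        mul_le_mul exp_numerics.1.le hs (Real.sqrt_nonneg _) (by norm_num)
      _ ≤ 10.452 := by norm_num

/-- `1.25·10⁸·(m+3)·m²·7.39^m < 506^m` for every `m ≥ 7`. [this track, ATTEMPT-21 §6] -/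
theorem pow_dominates_small (m : ℕ) (hm : 7 ≤ m) :
    (1.25e8 : ℝ) * ((m : ℝ) + 3) * (m : ℝ) ^ 2 * 7.39 ^ m < 506 ^ m := by
  induction m, hm using Nat.le_induction with
  | base => norm_num
  | succ k hk ih =>
    have hk' : (7 : ℝ) ≤ k := by exact_mod_cast hk
    have h739 : (0 : ℝ) < 7.39 ^ k := by positivity
    have e1 : ((k + 1 : ℕ) : ℝ) = (k : ℝ) + 1 := by push_cast; ring
    have e2 : (7.39 : ℝ) ^ (k + 1) = 7.39 ^ k * 7.39 := pow_succ _ _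
    have e3 : (506 : ℝ) ^ (k + 1) = 506 ^ k * 506 := pow_succ _ _
    rw [e1, e2, e3]
    -- `LHS(k+1) ≤ 506 · LHS(k)`: `7.39 (k+4)(k+1)² ≤ 506 (k+3) k²` for `k ≥ 7`
    have hpoly : 7.39 * (((k : ℝ) + 1 + 3) * ((k : ℝ) + 1) ^ 2) ≤ 506 * (((k : ℝ) + 3) * (k : ℝ) ^ 2) := by
      nlinarith [hk', sq_nonneg (k : ℝ)]
    have hstep := mul_le_mul_of_nonneg_left hpoly (by positivity : (0 : ℝ) ≤ 1.25e8 * 7.39 ^ k)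
    have e4 : (1.25e8 : ℝ) * ((k : ℝ) + 1 + 3) * ((k : ℝ) + 1) ^ 2 * (7.39 ^ k * 7.39) =
        1.25e8 * 7.39 ^ k * (7.39 * (((k : ℝ) + 1 + 3) * ((k : ℝ) + 1) ^ 2)) := by ring
    have e5 : (1.25e8 : ℝ) * 7.39 ^ k * (506 * (((k : ℝ) + 3) * (k : ℝ) ^ 2)) =
        506 * (1.25e8 * ((k : ℝ) + 3) * (k : ℝ) ^ 2 * 7.39 ^ k) := by ring
    rw [e4]
    calc (1.25e8 : ℝ) * 7.39 ^ k * (7.39 * (((k : ℝ) + 1 + 3) * ((k : ℝ) + 1) ^ 2))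
        ≤ 1.25e8 * 7.39 ^ k * (506 * (((k : ℝ) + 3) * (k : ℝ) ^ 2)) := hstep
      _ = 506 * (1.25e8 * ((k : ℝ) + 3) * (k : ℝ) ^ 2 * 7.39 ^ k) := e5
      _ < 506 * 506 ^ k := by nlinarith [ih]
      _ = 506 ^ k * 506 := by ring

/-! ## The two regimes -/

/-- **Regime `b ≥ 7`** (single Stirling term `m = ⌊b⌋`). [this track, ATTEMPT-21 §6] -/
theorem profile_value_regimeII {b x Φ : ℝ} (hb : 7 ≤ b) (hx : 9 / 2 * b ^ 3 ≤ x)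
    (hΦ : HasSum (fun m : ℕ => x ^ m / ((m.factorial : ℝ) * ((2 * m).factorial : ℝ))) Φ) :
    154000 * (b + 1.84) * Real.exp (2 * b) < Φ ^ 2 := by
  have hb0 : 0 < b := by linarith
  have hx0 : 0 ≤ x := le_trans (by positivity) hx
  set m : ℕ := ⌊b⌋₊ with hm
  have hmb : (m : ℝ) ≤ b := Nat.floor_le hb0.le
  have hbm : b < (m : ℝ) + 1 := Nat.lt_floor_add_one b
  have hm7 : 7 ≤ m := by rw [hm]; exact Nat.le_floor (by exact_mod_cast hb)
  have hm1 : 1 ≤ m := le_trans (by norm_num) hm7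
  have hm0 : (0 : ℝ) < m := by exact_mod_cast (lt_of_lt_of_le (by norm_num) hm7)
  have hm7' : (7 : ℝ) ≤ m := by exact_mod_cast hm7
  obtain ⟨he3, hes⟩ := exp_three_sqrt_two_bounds
  -- the single term and its Stirling minorant
  have hterm := profileTerm_le_of_hasSum hx0 hΦ m
  have hst := profileTerm_ge_stirling hx0 hm1
  -- base `e³x/(4m³) ≥ 22.5`
  have hbase : (22.5 : ℝ) ≤ Real.exp 3 * x / (4 * (m : ℝ) ^ 3) := by
    rw [le_div_iff₀ (by positivity)]
    have h1 : (m : ℝ) ^ 3 ≤ b ^ 3 := pow_le_pow_left₀ hm0.le hmb 3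
    have h2 : Real.exp 3 * (9 / 2 * b ^ 3) ≤ Real.exp 3 * x := mul_le_mul_of_nonneg_left hx (Real.exp_pos 3).le
    nlinarith [h1, h2, he3, pow_pos hb0 3]
  have hpow : (22.5 : ℝ) ^ m ≤ (Real.exp 3 * x / (4 * (m : ℝ) ^ 3)) ^ m := pow_le_pow_left₀ (by norm_num) hbase m
  have hΦge : (22.5 : ℝ) ^ m / (10.452 * m) ≤ Φ := by
    have h1 : (22.5 : ℝ) ^ m / (10.452 * m) ≤ (22.5 : ℝ) ^ m / (Real.exp 2 * Real.sqrt 2 * m) :=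
      div_le_div_of_nonneg_left (by positivity) (by positivity) (by nlinarith [hes, hm0])
    have h2 : (22.5 : ℝ) ^ m / (Real.exp 2 * Real.sqrt 2 * m) ≤
        (Real.exp 3 * x / (4 * (m : ℝ) ^ 3)) ^ m / (Real.exp 2 * Real.sqrt 2 * m) :=
      div_le_div_of_nonneg_right hpow (by positivity)
    linarith [h1, h2, hst, hterm]
  have hΦ0 : 0 ≤ (22.5 : ℝ) ^ m / (10.452 * m) := by positivity
  have hΦsq : ((22.5 : ℝ) ^ m / (10.452 * m)) ^ 2 ≤ Φ ^ 2 := pow_le_pow_left₀ hΦ0 hΦge 2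
  refine lt_of_lt_of_le ?_ hΦsq
  -- right side: `154000 (b+1.84) e^{2b} < 154000 (m+2.84) 7.39^{m+1}`
  have he2b : Real.exp (2 * b) < 7.39 ^ (m + 1) := by
    have h1 : Real.exp (2 * b) < Real.exp (2 * ((m : ℝ) + 1)) := Real.exp_lt_exp.2 (by linarith)
    have h2 : Real.exp (2 * ((m : ℝ) + 1)) = Real.exp 2 ^ (m + 1) := by
      rw [← Real.exp_nat_mul]; push_cast; ring_nf
    have h3 : Real.exp 2 ^ (m + 1) ≤ 7.39 ^ (m + 1) := pow_le_pow_left₀ (Real.exp_pos 2).le exp_numerics.1.le _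
    linarith [h1, h2 ▸ h3]
  have hdom := pow_dominates_small m hm7
  have e1 : ((22.5 : ℝ) ^ m / (10.452 * m)) ^ 2 = (506.25 : ℝ) ^ m / (109.244304 * (m : ℝ) ^ 2) := by
    rw [div_pow, mul_pow, ← pow_mul, mul_comm m 2, pow_mul]; norm_num
  rw [e1, lt_div_iff₀ (by positivity)]
  have h506 : (506 : ℝ) ^ m ≤ 506.25 ^ m := pow_le_pow_left₀ (by norm_num) (by norm_num) m
  have hpos : 0 < 154000 * (b + 1.84) := by positivity
  have h4 : 154000 * (b + 1.84) * Real.exp (2 * b) * (109.244304 * (m : ℝ) ^ 2) <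
      154000 * ((m : ℝ) + 2.84) * 7.39 ^ (m + 1) * (109.244304 * (m : ℝ) ^ 2) := by
    have a1 : 154000 * (b + 1.84) * Real.exp (2 * b) < 154000 * (b + 1.84) * 7.39 ^ (m + 1) :=
      mul_lt_mul_of_pos_left he2b hpos
    have a2 : 154000 * (b + 1.84) * 7.39 ^ (m + 1) ≤ 154000 * ((m : ℝ) + 2.84) * 7.39 ^ (m + 1) := by
      have : b + 1.84 ≤ (m : ℝ) + 2.84 := by linarith
      have h739 : (0 : ℝ) ≤ 7.39 ^ (m + 1) := by positivity
      nlinarith [this, h739]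
    have hm2 : (0 : ℝ) < 109.244304 * (m : ℝ) ^ 2 := by positivity
    nlinarith [a1, a2, hm2]
  refine lt_of_lt_of_le h4 ?_
  rw [pow_succ]
  have h5 : 154000 * ((m : ℝ) + 2.84) * (7.39 ^ m * 7.39) * (109.244304 * (m : ℝ) ^ 2) ≤
      1.25e8 * ((m : ℝ) + 3) * (m : ℝ) ^ 2 * 7.39 ^ m := by
    have hA : 154000 * 7.39 * 109.244304 * ((m : ℝ) + 2.84) ≤ 1.25e8 * ((m : ℝ) + 3) := by nlinarith [hm7']
    have hB : (0 : ℝ) ≤ (m : ℝ) ^ 2 * 7.39 ^ m := by positivity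
    calc 154000 * ((m : ℝ) + 2.84) * (7.39 ^ m * 7.39) * (109.244304 * (m : ℝ) ^ 2)
        = (154000 * 7.39 * 109.244304 * ((m : ℝ) + 2.84)) * ((m : ℝ) ^ 2 * 7.39 ^ m) := by ring
      _ ≤ (1.25e8 * ((m : ℝ) + 3)) * ((m : ℝ) ^ 2 * 7.39 ^ m) := mul_le_mul_of_nonneg_right hA hB
      _ = 1.25e8 * ((m : ℝ) + 3) * (m : ℝ) ^ 2 * 7.39 ^ m := by ring
  linarith [h5, hdom, h506]

/-- **Regime `11/2 ≤ b < 7`** (partial sums at `x = 748.6875`, `x = 972`). [this track, ATTEMPT-21 §6] -/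
theorem profile_value_regimeI {b x Φ : ℝ} (hb : 11 / 2 ≤ b) (hb7 : b < 7) (hx : 9 / 2 * b ^ 3 ≤ x)
    (hΦ : HasSum (fun m : ℕ => x ^ m / ((m.factorial : ℝ) * ((2 * m).factorial : ℝ))) Φ) :
    154000 * (b + 1.84) * Real.exp (2 * b) < Φ ^ 2 := by
  have hx0 : 0 ≤ x := le_trans (by positivity) hx
  obtain ⟨he12, he14⟩ := exp_twelve_fourteen_le
  have hS := profileSum_le_of_hasSum hx0 hΦ 11
  rcases lt_or_ge b 6 with hb6 | hb6
  · -- cell `[11/2, 6)`: `x ≥ 748.6875`, `Φ ≥ 1.9e6`, `e^{2b} ≤ e^{12}`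
    have hx1 : (11979 : ℝ) / 16 ≤ x := by
      have h3 := pow_le_pow_left₀ (by norm_num : (0:ℝ) ≤ 11 / 2) hb 3
      exact le_trans (by nlinarith [h3]) hx
    have hΦge : (1900000 : ℝ) ≤ Φ :=
      le_trans profileSum_ge_cell_one ((profileSum_mono (by norm_num) hx1 11).trans hS)
    have hΦsq : (1900000 : ℝ) ^ 2 ≤ Φ ^ 2 := pow_le_pow_left₀ (by norm_num) hΦge 2
    refine lt_of_lt_of_le ?_ hΦsq
    have h1 : Real.exp (2 * b) ≤ 162755 := le_trans (Real.exp_le_exp.2 (by linarith)) he12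
    have h2 : 154000 * (b + 1.84) ≤ 154000 * 7.84 := by nlinarith
    calc 154000 * (b + 1.84) * Real.exp (2 * b) ≤ 154000 * 7.84 * 162755 :=
          mul_le_mul h2 h1 (Real.exp_pos _).le (by norm_num)
      _ < 1900000 ^ 2 := by norm_num
  · -- cell `[6, 7)`: `x ≥ 972`, `Φ ≥ 8.8e6`, `e^{2b} ≤ e^{14}`
    have hx1 : (972 : ℝ) ≤ x := by
      have h3 := pow_le_pow_left₀ (by norm_num : (0:ℝ) ≤ 6) hb6 3
      exact le_trans (by nlinarith [h3]) hx
    have hΦge : (8800000 : ℝ) ≤ Φ :=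
      le_trans profileSum_ge_cell_two ((profileSum_mono (by norm_num) hx1 11).trans hS)
    have hΦsq : (8800000 : ℝ) ^ 2 ≤ Φ ^ 2 := pow_le_pow_left₀ (by norm_num) hΦge 2
    refine lt_of_lt_of_le ?_ hΦsq
    have h1 : Real.exp (2 * b) ≤ 1202605 := le_trans (Real.exp_le_exp.2 (by linarith)) he14
    have h2 : 154000 * (b + 1.84) ≤ 154000 * 8.84 := by nlinarith
    calc 154000 * (b + 1.84) * Real.exp (2 * b) ≤ 154000 * 8.84 * 1202605 :=
          mul_le_mul h2 h1 (Real.exp_pos _).le (by norm_num)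
      _ < 8800000 ^ 2 := by norm_num

/-- **Part (5) of the small-threshold discharge: the profile value at `y = 2L^{3/2}`.** For every `b ≥ 11/2`, `2b ≤ L`,
`y = 2L√L` and `Φ = Σ_m (9y²/64)^m/(m!(2m)!)`: **`154000·(b+1.84)·e^{2b} < Φ²`**. [this track, ATTEMPT-21 §6] -/
theorem profile_value_small {b L y Φ : ℝ} (hb : 11 / 2 ≤ b) (hL1 : 2 * b ≤ L) (hy : y = 2 * (L * Real.sqrt L))
    (hΦ : HasSum (fun m : ℕ => (9 * y ^ 2 / 64) ^ m / ((m.factorial : ℝ) * ((2 * m).factorial : ℝ))) Φ) :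
    154000 * (b + 1.84) * Real.exp (2 * b) < Φ ^ 2 := by
  have hb0 : 0 < b := by linarith
  have hL0 : 0 ≤ L := by linarith
  have hx : 9 / 2 * b ^ 3 ≤ 9 * y ^ 2 / 64 := by
    have hy2 : y ^ 2 = 4 * L ^ 3 := by rw [hy, mul_pow, mul_pow, Real.sq_sqrt hL0]; ring
    rw [hy2]
    have : (2 * b) ^ 3 ≤ L ^ 3 := pow_le_pow_left₀ (by positivity) hL1 3
    nlinarith [this]
  rcases lt_or_ge b 7 with hb7 | hb7
  · exact profile_value_regimeI hb hb7 hx hΦ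
  · exact profile_value_regimeII hb7 hx hΦ

end Summit.RiemannHypothesis.RiemannHypothesis.Theorems.Handoff

end
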